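/-
Copyright (c) 2026. Released under Apache 2.0 license.
-/
import Mathlib.GroupTheory.Commutator.Basic
import Mathlib.Tactic.Group
import HarnessLib

/-!
# Commutators of `⟨t⟩ · A` with `A` abelian

The abstract group-theoretic step behind the `p²`-layer of the invariant form of CDT Cor. 4.5.3 (the Schur
multiplier of `SL₂(ℤ/p²)` at `p`, [Beyl1986]): if `A ≤ G` is an abelian subgroup normalised by `t`, then the
commutator subgroup of `L = ⟨t, A⟩` is `{t a t⁻¹ a⁻¹ : a ∈ A}` (`commutator_closure_le_range`); consequently a
subgroup `Z` meets `[L, L]` trivially as soon as no non-trivial `t a t⁻¹ a⁻¹` lies in `Z`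
(`eq_one_of_mem_of_mem_commutator_closure`).  In the application `L` is the preimage of the Sylow `p`-subgroup
`⟨T̄⟩ · (Γ(p)/Γ(p²))` of `SL₂(ℤ/p²)` in a central extension realised by `SL₂(ℤ)`, `A` the (abelian) image of
`Γ(p)` and `Z` the centre coming from `Γ(p²)`.

[cite: CalegariDimitrovTang2025, Corollary 4.5.3] [cite: Beyl1986, Theorem]
-/

open scoped commutatorElement

namespace Literature.NumberTheory.Automorphic

namespace UnboundedDenominators

variable {G : Type*} [Group G]

/-- For an abelian subgroup `A` normalised by `t`, `a ↦ t a t⁻¹ a⁻¹` is a homomorphism `A → G`.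
[folklore] [cite: CalegariDimitrovTang2025, Corollary 4.5.3] -/
theorem exists_commutatorHom (A : Subgroup G) (t : G) (hA : ∀ a ∈ A, ∀ b ∈ A, a * b = b * a)
    (ht : ∀ a ∈ A, t * a * t⁻¹ ∈ A) :
    ∃ δ : A →* G, ∀ a : A, δ a = t * a * t⁻¹ * (a : G)⁻¹ := by
  refine ⟨{ toFun := fun a ↦ t * a * t⁻¹ * (a : G)⁻¹
            map_one' := by simp
            map_mul' := fun a b ↦ ?_ }, fun a ↦ rfl⟩
  have c1 : ((b : G))⁻¹ * ((a : G))⁻¹ = ((a : G))⁻¹ * ((b : G))⁻¹ :=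
    hA _ (inv_mem b.2) _ (inv_mem a.2)
  have c2 : t * b * t⁻¹ * ((a : G))⁻¹ = ((a : G))⁻¹ * (t * b * t⁻¹) := hA _ (ht _ b.2) _ (inv_mem a.2)
  have key : t * b * t⁻¹ * (((b : G))⁻¹ * ((a : G))⁻¹) = ((a : G))⁻¹ * (t * b * t⁻¹ * ((b : G))⁻¹) := by
    rw [c1, ← mul_assoc, c2, mul_assoc, mul_assoc]
  calc t * ((a * b : A) : G) * t⁻¹ * (((a * b : A) : G))⁻¹
      = t * a * t⁻¹ * (t * b * t⁻¹ * (((b : G))⁻¹ * ((a : G))⁻¹)) := by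
        rw [Subgroup.coe_mul, mul_inv_rev]; group
    _ = t * a * t⁻¹ * (((a : G))⁻¹ * (t * b * t⁻¹ * ((b : G))⁻¹)) := by rw [key]
    _ = t * a * t⁻¹ * ((a : G))⁻¹ * (t * b * t⁻¹ * ((b : G))⁻¹) := by group

/-- **`[⟨t, A⟩, ⟨t, A⟩] = {t a t⁻¹ a⁻¹}` for `A` abelian normalised by `t`**: every commutator of
`L = ⟨t⟩ · A` is of the form `t a t⁻¹ a⁻¹`, `a ∈ A`. [cite: CalegariDimitrovTang2025, Corollary 4.5.3] -/
theorem commutator_closure_le_range (A : Subgroup G) (t : G) (hA : ∀ a ∈ A, ∀ b ∈ A, a * b = b * a)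
    (ht : ∀ a ∈ A, t * a * t⁻¹ ∈ A) (ht' : ∀ a ∈ A, t⁻¹ * a * t ∈ A) (δ : A →* G)
    (hδ : ∀ a : A, δ a = t * a * t⁻¹ * (a : G)⁻¹) :
    ⁅Subgroup.closure ({t} ∪ (A : Set G)), Subgroup.closure ({t} ∪ (A : Set G))⁆ ≤ δ.range := by
  set L := Subgroup.closure ({t} ∪ (A : Set G)) with hL
  set D := δ.range with hD
  have hDmem : ∀ a ∈ A, t * a * t⁻¹ * a⁻¹ ∈ D := fun a ha ↦ ⟨⟨a, ha⟩, hδ ⟨a, ha⟩⟩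
  have hDA : D ≤ A := by
    rintro _ ⟨a, rfl⟩
    rw [hδ]
    exact mul_mem (ht _ a.2) (inv_mem a.2)
  -- `D` is normalised by `L`
  have C1 : ∀ x ∈ L, ∀ d ∈ D, x * d * x⁻¹ ∈ D ∧ x⁻¹ * d * x ∈ D := by
    intro x hx
    induction hx using Subgroup.closure_induction with
    | mem x hx =>
      intro d hd
      obtain ⟨a, rfl⟩ := hd
      rw [hδ]
      rcases hx with rfl | hx
      · constructor
        · have h := hDmem _ (ht _ a.2)
          rw [show x * (x * a * x⁻¹) * x⁻¹ * (x * a * x⁻¹)⁻¹ = x * (x * a * x⁻¹ * (a : G)⁻¹) * x⁻¹ by group]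
            at h
          exact h
        · have h := hDmem _ (ht' _ a.2)
          rw [show x * (x⁻¹ * a * x) * x⁻¹ * (x⁻¹ * a * x)⁻¹ = x⁻¹ * (x * a * x⁻¹ * (a : G)⁻¹) * x by group]
            at h
          exact h
      · have hd : t * a * t⁻¹ * (a : G)⁻¹ ∈ A := mul_mem (ht _ a.2) (inv_mem a.2)
        constructor
        · rw [show x * (t * a * t⁻¹ * (a : G)⁻¹) * x⁻¹ = t * a * t⁻¹ * (a : G)⁻¹ by
            rw [hA x hx _ hd, mul_assoc, mul_inv_cancel, mul_one]]
          exact hDmem _ a.2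
        · rw [show x⁻¹ * (t * a * t⁻¹ * (a : G)⁻¹) * x = t * a * t⁻¹ * (a : G)⁻¹ by
            rw [mul_assoc, ← hA x hx _ hd, ← mul_assoc, inv_mul_cancel, one_mul]]
          exact hDmem _ a.2
    | one => intro d hd; simpa using hd
    | mul x y _ _ ihx ihy =>
      intro d hd
      constructor
      · rw [show x * y * d * (x * y)⁻¹ = x * (y * d * y⁻¹) * x⁻¹ by group]
        exact (ihx _ (ihy d hd).1).1
      · rw [show (x * y)⁻¹ * d * (x * y) = y⁻¹ * (x⁻¹ * d * x) * y by group]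
        exact (ihy _ (ihx d hd).2).2
    | inv x _ ih =>
      intro d hd
      constructor
      · simpa using (ih d hd).2
      · simpa using (ih d hd).1
  -- every commutator of two elements of `L` lies in `D`
  have C2 : ∀ x ∈ L, ∀ y ∈ L, ⁅x, y⁆ ∈ D := by
    intro x hx y hy
    induction hx, hy using Subgroup.closure_induction₂ with
    | mem x y hx hy =>
      rcases hx with rfl | hx <;> rcases hy with rfl | hy
      · rw [commutatorElement_def, mul_inv_cancel_right, mul_inv_cancel]; exact one_mem _
      · rw [commutatorElement_def]; exact hDmem y hy
      · rw [← commutatorElement_inv, commutatorElement_def]; exact inv_mem (hDmem x hx)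
      · rw [commutatorElement_def, hA x hx y hy,
          show y * x * x⁻¹ * y⁻¹ = 1 by rw [mul_inv_cancel_right, mul_inv_cancel]]
        exact one_mem _
    | one_left x _ => rw [commutatorElement_one_left]; exact one_mem _
    | one_right x _ => rw [commutatorElement_one_right]; exact one_mem _
    | mul_left x y z hx _ _ h1 h2 =>
      rw [show ⁅x * y, z⁆ = x * ⁅y, z⁆ * x⁻¹ * ⁅x, z⁆ by simp only [commutatorElement_def]; group]
      exact mul_mem ((C1 x hx _ h2).1) h1
    | mul_right y z x hy _ _ h1 h2 =>
      rw [show ⁅x, y * z⁆ = ⁅x, y⁆ * (y * ⁅x, z⁆ * y⁻¹) by simp only [commutatorElement_def]; group]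
      exact mul_mem h1 ((C1 y hy _ h2).1)
    | inv_left x y hx _ h =>
      rw [show ⁅x⁻¹, y⁆ = x⁻¹ * ⁅x, y⁆⁻¹ * x by simp only [commutatorElement_def]; group]
      exact (C1 x hx _ (inv_mem h)).2
    | inv_right x y _ hy h =>
      rw [show ⁅x, y⁻¹⁆ = y⁻¹ * ⁅x, y⁆⁻¹ * y by simp only [commutatorElement_def]; group]
      exact (C1 y hy _ (inv_mem h)).2
  exact Subgroup.commutator_le.mpr C2

/-- **Central extensions of `⟨T̄⟩ ⋉ V`-type groups**: let `A ≤ G` be abelian and normalised by `t`, and let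
`Z ≤ G` be a subgroup such that `t a t⁻¹ a⁻¹ ∈ Z` (for `a ∈ A`) forces `t a t⁻¹ = a`.  Then `Z` meets the
commutator subgroup of `L = ⟨t, A⟩` trivially. [cite: CalegariDimitrovTang2025, Corollary 4.5.3]
[cite: Beyl1986, Theorem] -/
theorem eq_one_of_mem_of_mem_commutator_closure (Z A : Subgroup G) (t : G)
    (hA : ∀ a ∈ A, ∀ b ∈ A, a * b = b * a) (ht : ∀ a ∈ A, t * a * t⁻¹ ∈ A)
    (ht' : ∀ a ∈ A, t⁻¹ * a * t ∈ A) (hker : ∀ a ∈ A, t * a * t⁻¹ * a⁻¹ ∈ Z → t * a * t⁻¹ * a⁻¹ = 1)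
    {z : G} (hzZ : z ∈ Z)
    (hz : z ∈ ⁅Subgroup.closure ({t} ∪ (A : Set G)), Subgroup.closure ({t} ∪ (A : Set G))⁆) : z = 1 := by
  obtain ⟨δ, hδ⟩ := exists_commutatorHom A t hA ht
  obtain ⟨a, ha⟩ := commutator_closure_le_range A t hA ht ht' δ hδ hz
  rw [hδ] at ha
  rw [← ha] at hzZ ⊢
  exact hker _ a.2 hzZ

end UnboundedDenominators

end Literature.NumberTheory.Automorphic
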